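import Summits.Ventures.LatticeQCDFlow.Scaling.WilsonSpecificHeatFloorShift
import Summits.Ventures.LatticeQCDFlow.Scaling.WilsonSpecificHeatFloorDeriv
import Summits.Ventures.LatticeQCDFlow.Scaling.WilsonSpecificHeatFloorCasimir
import Summits.Ventures.LatticeQCDFlow.Scaling.SpecificHeatFloorLog2Law
import Literature.MathematicalPhysics.QuantumLattice.NarrowWellTorusPressure
import HarnessLib

/-!
HONEST FRAMING: exact (Metropolis-corrected) sampling algorithms for lattice gauge theory; figures
of merit are autocorrelation/cost numbers at stated couplings and volumes; no continuum-physics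
claim.

# The Wilson specific-heat floor, uniform in the volume (item 125's (SH_W))

THEORY-2 item 128 (theory2 GEN-41, HOME tier; cell pub-lqcd / Ventures/LatticeQCDFlow).
PART 4 of 4 (§E the assembly, §F the docking with item 125).  CUSTODY: theory2 item 128 (GEN-41, HOME tier) re-landed by lean-2 GEN-10 per LEAD LINE 255 RL-47 (116);
statements and proofs = HOME/lean/theory2/WilsonSpecificHeatFloor.lean 07cab9e5ed9822d9 (1 031 l)
verbatim, split below the `lint.size` line into FOUR files (`WilsonSpecificHeatFloorShift` §A,
`WilsonSpecificHeatFloorDeriv` §B1–§B4, `WilsonSpecificHeatFloorCasimir` §C–§D,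
`WilsonSpecificHeatFloor` §E–§F; parts 1–3 are mutually independent, part 4 imports them); headers
trimmed; imports = HOME's (its three `Scaling.*` placeholder lines ARE the tree module names of items
125 / 126 / 127 as landed by lean-2 GEN-9) minus item 125, which only PART 4 §F needs; landing edits:
docstrings added where the lint asks (builder `build128.py` in the custodian's seat folder); PART 4 only: HOME's `card_site` (`|(ℤ/L)^d| = L^d`, l.803–804) deleted in
favour of the identical landed Literature lemma `NarrowWell.card_site` (gate `dedup.landed`) and its one use
(l.905) re-pointed.

PREREQUISITES (all tree modules now): items 125 / 126 / 127 =
`Summits.Ventures.LatticeQCDFlow.Scaling.{SpecificHeatFloorLog2Law, ExtensiveSpecificHeat,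
SchwingerDysonVarianceFloor}` (custody landings lean-2 GEN-9, LEAD LINE 245); theory2's HOME certificate
was the concatenation `HOME/lean/theory2/check/WilsonSpecificHeatFloor_concat.lean` a52c694ea12c3c08 =
item 125 ‖ 126 ‖ 127 ‖ item 128 (`lean check` rc 0 · 0 sorry · axioms of the main theorems
`[propext, Classical.choice, Quot.sound]`); the custodian re-checked PARTS 1 ‖ 2 ‖ 3 ‖ 4 against the
tree before landing.  Item 125 is needed only for the docking section §F; §§A–E use items 126 and 127.

**Main theorem** (`wilsonSpecificHeatFloorUniform`).  Pure `SU(n)` lattice gauge theory with the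
Wilson action `S_W = Σ_p Re tr(1 − U_p)` on the torus `(ℤ/L)^d`, ensembles
`π_u = 𝒵⁻¹ e^{−u S_W} D[U]` (Lüscher's ambient framework, tree `TrivializingMaps`).  For every
`n ≥ 2`, `d ≥ 2` and `β₀ > 0` there is a constant `c = c(d, n, β₀) > 0` such that

  `∀ L ≥ 2, ∀ u ≥ β₀:   Var_{π_u}(S_W) ≥ c · #plaquettes(d, L) / u²`,

stated token for token as the body of item 125's `WilsonSpecificHeatFloorUniform d n β₀ c`, and
DOCKED by definitional unfolding
(§F, `wilsonSpecificHeatFloorUniform_holds : ∃ c > 0, WilsonSpecificHeatFloorUniform d n β₀ c`).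
Hence item 125's conditional laws for the Wilson action are UNCONDITIONAL (§F:
`wilson_protocolLaw`, `wilson_layers_necessary`, `wilson_logRatio_le_of_stepCost` — for some
`c = c(d,n,β₀) > 0`, in every volume `L ≥ 2`, for every monotone protocol of exact reweighting
steps started at `b₀ ≥ β₀`: `Σ_j log E[w_j²] ≥ c·#plaq·log²R/(m + log R)`, so
`m ≥ c·#plaq·log²R/t − log R` layers are necessary at total cost `t`, and
`log R ≤ m(t₀/K + √(t₀/K))`, `K = c·#plaq`, at per-step cost `t₀`): the hypothesis (SH_W) that
item 125 typed and items 126/127 reduced is a theorem.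

**Proof** (all constants volume-free).
* (E) item 127's Schwinger–Dyson floor `variance_ge_of_sumMeanLap` for `S = S_W`, the standard basis
  `Y = T` of `𝔰𝔲(n)` and the non-interacting even link family `M = evenLinks μ` (`|M| = ⌊L/2⌋^d`):
  `Var_u(S_W) ≥ |M| m₀² / (k²(2c₂² + c₁c₃)) / u²` given sup bounds `c₁, c₂, c₃` on the first three
  link derivatives of `S_W` along `T` (§B: uniform in `L`, by the chain rule through the fixed
  four-link function `refPlaq` and compactness of `SU(n)^4`), link-locality of `S_W` on `M` (§B4)
  and a floor `Σ_{e∈M} E_u[Δ_e S_W] ≥ |M| m₀`.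
* (CAS) §C: the global Casimir identity `Σ_e Δ_e S_W = 4C_F (c − S_W)` pointwise
  (`C_F = (n²−1)/(2n)`; each `Re tr U_p` is an eigenfunction of every one of its four link
  Laplacians, Literature `linkLap_re_trace_plaquette`), and `c = E_0[S_W]` by integration by parts
  at `u = 0`.
* (MP) §D: `E_0[S_W] − E_u[S_W] = ∫_0^u Var_t(S_W) dt ≥ β₀ · L⌊L/2⌋^{d−1} e^{−8n(d−1)β₀} V_H`
  (fluctuation relation `meanAction_sub_eq_integral_variance` + item 126's window floor
  `wilson_variance_ge_extensive_window`; `V_H = Var_Haar(Re tr g) > 0`).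
* (AVG) §A: torus translations act on configurations, commute with link derivatives and preserve
  `S_W` and `π_u` (Literature `wilsonExpectation_comp_torusConfigShift`), so `E_u[Δ_{(x,μ)} S_W]`
  does not depend on `x`; pigeonholing a direction `μ` gives `Σ_{e ∈ evenLinks μ} E_u[Δ_e S_W] =
  ⌊L/2⌋^d E_u[Δ_{(0,μ)}S_W] ≥ ⌊L/2⌋^d · m₀` with `m₀ = 4C_F β₀ e^{−8n(d−1)β₀} V_H / (d 3^{d−1})`.
* §E: `#plaquettes ≤ d² L^d ≤ d² 3^d ⌊L/2⌋^d` (Literature `LatticeForm.card_plaquette_le`),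
  `k = n² − 1 ≥ 3` (Literature `finrank_suAlgebra`), and `c = m₀² / (k²(2c₂²+c₁c₃) d² 3^d)`.

HONEST FRAMING.  The constant is explicit but poor: `c` carries the factor `e^{−16 n(d−1)β₀}` and
the compactness bounds `c₁, c₂, c₃`, far below the weak-coupling (Gaussian) expectation
`c ≈ (n²−1)/d` recorded in item 125's docstring; the rate `u⁻²` on `[β₀, ∞)` is the right one.  The
theorem is a rigorous, volume-uniform, every-coupling LOWER bound obtained without cluster
expansions; nothing here is a Monte-Carlo statement, and no Statement file is touched.

References: M. Lüscher, Commun. Math. Phys. 293 (2010) 899 [arXiv:0907.5491] §§3–4, App. A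
(link derivatives, `Δ Re tr U_p = −4C_F Re tr U_p`, Schwinger–Dyson / field-transformation
identities);
M. Creutz, *Quarks, gluons and lattices* (1983) ch. 9–10 (mean plaquette, specific heat);
I. Montvay–G. Münster, *Quantum fields on a lattice* (1994) §3.2.
-/

noncomputable section

set_option linter.unusedSectionVars false

namespace Summit.Ventures.LatticeQCDFlow.Theory2.WilsonSpecificHeat

open MeasureTheory ProbabilityTheory
open Literature.MathematicalPhysics.QuantumFieldTheory
open Literature.MathematicalPhysics.QuantumFieldTheory.Luscher2010
open Literature.MathematicalPhysics.QuantumFieldTheory.WilsonFlow (coeConfig continuous_coeConfig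
  coeConfig_apply)
open Summit.Ventures.LatticeQCDFlow.TrivializingMaps
open Summit.Ventures.LatticeQCDFlow.Theory2.SchwingerDyson (dirLap)
open scoped Matrix Matrix.Norms.Frobenius ContDiff

variable {d L n : ℕ}

/-! ## §E. Assembly: the Wilson specific-heat floor, uniform in the volume -/

section Assembly

/-- `|stdSuBasis n| = n² − 1`. [Literature `finrank_suAlgebra`] -/
theorem card_stdSuBasis (n : ℕ) :
    Fintype.card (SuBasisExistence.stdSuBasis n).ι = n ^ 2 - 1 := by
  show Fintype.card (Fin (Module.finrank ℝ (suAlgebra n))) = _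
  rw [Fintype.card_fin, Literature.MathematicalPhysics.QuantumLattice.finrank_suAlgebra]

variable [NeZero L]

/-- The mean Laplacian of a link of the even family in direction `μ` is that of `(0, μ)`. -/
theorem sum_evenLinks_integral_dirLap {ι : Type*} [Fintype ι] (Y : ι → Matrix (Fin n) (Fin n) ℂ)
    (β : ℝ) (μ : Fin d) :
    ∑ e ∈ evenLinks (L := L) μ,
      ∫ U, dirLap Y (ambWilsonAction : AmbConfig d L n → ℝ) e (coeConfig U)
        ∂(boltzmannMeasure fun U : GaugeConfig d L (Matrix.specialUnitaryGroup (Fin n) ℂ) =>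
          β * ambWilsonAction (coeConfig U)) =
      (evenLinks (L := L) μ).card *
        ∫ U, dirLap Y (ambWilsonAction : AmbConfig d L n → ℝ) ((0 : Site d L), μ) (coeConfig U)
          ∂(boltzmannMeasure fun U : GaugeConfig d L (Matrix.specialUnitaryGroup (Fin n) ℂ) =>
            β * ambWilsonAction (coeConfig U)) := by
  rw [← nsmul_eq_mul, ← Finset.sum_const]
  refine Finset.sum_congr rfl fun e he => ?_
  simp only [evenLinks, Finset.mem_image, Finset.mem_univ, true_and] at he
  obtain ⟨x, rfl⟩ := he
  exact integral_dirLap_eq_origin Y β (evenSite x) μ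

/-- The total mean Laplacian is `L^d · Σ_μ E[Δ_{(0,μ)}S_W]`. -/
theorem sum_integral_dirLap_eq_directions {ι : Type*} [Fintype ι]
    (Y : ι → Matrix (Fin n) (Fin n) ℂ) (β : ℝ) :
    ∑ e, ∫ U, dirLap Y (ambWilsonAction : AmbConfig d L n → ℝ) e (coeConfig U)
        ∂(boltzmannMeasure fun U : GaugeConfig d L (Matrix.specialUnitaryGroup (Fin n) ℂ) =>
          β * ambWilsonAction (coeConfig U)) =
      (Fintype.card (Site d L) : ℝ) * ∑ μ : Fin d,
        ∫ U, dirLap Y (ambWilsonAction : AmbConfig d L n → ℝ) ((0 : Site d L), μ) (coeConfig U)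
          ∂(boltzmannMeasure fun U : GaugeConfig d L (Matrix.specialUnitaryGroup (Fin n) ℂ) =>
            β * ambWilsonAction (coeConfig U)) := by
  rw [Fintype.sum_prod_type, ← Finset.card_univ, ← nsmul_eq_mul, ← Finset.sum_const]
  refine Finset.sum_congr rfl fun x _ => Finset.sum_congr rfl fun μ _ => ?_
  exact integral_dirLap_eq_origin Y β x μ

/-- Elementary: `L^{k+1} ≤ 3^{k+1} ⌊L/2⌋^{k+1}` and `L^{k+1} ≤ 3^k · L⌊L/2⌋^k` for `L ≥ 2`. -/
theorem pow_succ_le_three_pow_mul (hL : 2 ≤ L) (k : ℕ) :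
    (L : ℝ) ^ (k + 1) ≤ 3 ^ k * ((L * (L / 2) ^ k : ℕ) : ℝ) := by
  have h := pow_le_three_pow_mul_half_pow (d := k) hL
  have h' : ((L ^ k : ℕ) : ℝ) ≤ ((3 ^ k * (L / 2) ^ k : ℕ) : ℝ) := by exact_mod_cast h
  push_cast at h' ⊢
  have hL0 : (0 : ℝ) ≤ L := Nat.cast_nonneg _
  calc (L : ℝ) ^ (k + 1) = L * (L : ℝ) ^ k := by ring
    _ ≤ L * (3 ^ k * ((L / 2 : ℕ) : ℝ) ^ k) := mul_le_mul_of_nonneg_left h' hL0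
    _ = 3 ^ k * (L * ((L / 2 : ℕ) : ℝ) ^ k) := by ring

/-- **THEOREM (item 128). The Wilson specific-heat floor, uniform in the volume.**
For `n ≥ 2`, `d ≥ 2` and `β₀ > 0` there is `c = c(d, n, β₀) > 0` such that for every `L ≥ 2` and
every `u ≥ β₀`,
`Var_{π_u}(S_W) ≥ c · #plaquettes(d, L) / u²`,
i.e. — token for token — item 125's `WilsonSpecificHeatFloorUniform d n β₀ c`. [ours] -/
theorem wilsonSpecificHeatFloorUniform (hn : 2 ≤ n) (hd : 2 ≤ d) {β₀ : ℝ} (hβ₀ : 0 < β₀) :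
    ∃ c : ℝ, 0 < c ∧ ∀ (L : ℕ) [NeZero L], 2 ≤ L → ∀ u : ℝ, β₀ ≤ u →
      c * Fintype.card (Plaquette d L) / u ^ 2 ≤
        variance (fun U => ambWilsonAction (coeConfig U))
          (boltzmannMeasure fun U : GaugeConfig d L (Matrix.specialUnitaryGroup (Fin n) ℂ) =>
            u * ambWilsonAction (coeConfig U)) := by
  obtain ⟨d, rfl⟩ : ∃ d', d = d' + 2 := ⟨d - 2, by omega⟩
  set B := SuBasisExistence.stdSuBasis n with hB
  obtain ⟨c₁, c₂, c₃, hc₁, hc₂, hc₃, hbd⟩ := wilson_deriv_bounds (d + 2) n B.T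
  -- the single-link Haar variance `V_H` and the volume-free mean-Laplacian floor `m₀`
  set VH := variance (fun g : ↥(Matrix.specialUnitaryGroup (Fin n) ℂ) =>
      ((StrongCoupling.defRep n) g).trace.re)
      (haarProbability ↥(Matrix.specialUnitaryGroup (Fin n) ℂ)) with hVH
  have hVHpos : 0 < VH := haarVar_pos hn
  have hCF : 0 < casimirF n := casimirF_pos hn
  set m₀ : ℝ := 4 * casimirF n * (β₀ * Real.exp (-(8 * n * (d + 1) * β₀)) * VH) /
    (((d : ℝ) + 2) * 3 ^ (d + 1)) with hm₀
  have hm₀pos : 0 < m₀ := by positivity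
  set D : ℝ := (Fintype.card B.ι : ℝ) ^ 2 * (2 * c₂ ^ 2 + c₁ * c₃) with hD
  have hk : 0 < (Fintype.card B.ι : ℝ) := by
    have h4 : 4 ≤ n ^ 2 := by
      calc 4 = 2 ^ 2 := by norm_num
        _ ≤ n ^ 2 := Nat.pow_le_pow_left hn 2
    have : 0 < Fintype.card B.ι := by
      show 0 < Fintype.card (SuBasisExistence.stdSuBasis n).ι
      rw [card_stdSuBasis]; omega
    exact_mod_cast this
  have hDpos : 0 < D := by
    have : 0 < 2 * c₂ ^ 2 + c₁ * c₃ := by nlinarith [mul_nonneg hc₁ hc₃]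
    positivity
  refine ⟨m₀ ^ 2 / D / (((d : ℝ) + 2) ^ 2 * 3 ^ (d + 2)), by positivity, fun L _ hL u hβu => ?_⟩
  have hu0 : 0 < u := hβ₀.trans_le hβu
  have hS : ContDiff ℝ ∞ (ambWilsonAction : AmbConfig (d + 2) L n → ℝ) := contDiff_ambWilsonAction
  -- (MP)+(CAS)+(AVG): the total mean Laplacian, reduced to the `d + 2` directions at the origin
  have htot := sum_integral_dirLap_ge (d := d) hn hL B hβ₀.le hβu
  rw [sum_integral_dirLap_eq_directions B.T u] at htot
  set Dμ : Fin (d + 2) → ℝ := fun μ =>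
    ∫ U, dirLap B.T (ambWilsonAction : AmbConfig (d + 2) L n → ℝ) ((0 : Site (d + 2) L), μ)
      (coeConfig U)
      ∂(boltzmannMeasure fun U : GaugeConfig (d + 2) L (Matrix.specialUnitaryGroup (Fin n) ℂ) =>
        u * ambWilsonAction (coeConfig U)) with hDμ
  -- the direction carrying at least the average
  obtain ⟨μ, -, hμ⟩ : ∃ μ ∈ (Finset.univ : Finset (Fin (d + 2))),
      (∑ ν, Dμ ν) ≤ ((d + 2 : ℕ) : ℝ) * Dμ μ := by
    refine Finset.exists_le_of_sum_le Finset.univ_nonempty (le_of_eq ?_)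
    rw [Finset.sum_const, Finset.card_univ, Fintype.card_fin, nsmul_eq_mul, Finset.mul_sum]
  -- `m₀ ≤ E[Δ_{(0,μ)} S_W]`
  have hX : (L : ℝ) ^ (d + 2) ≤ 3 ^ (d + 1) * ((L * (L / 2) ^ (d + 1) : ℕ) : ℝ) :=
    pow_succ_le_three_pow_mul hL (d + 1)
  have hsite : (Fintype.card (Site (d + 2) L) : ℝ) = (L : ℝ) ^ (d + 2) := by
    rw [Literature.MathematicalPhysics.QuantumLattice.NarrowWell.card_site, Nat.cast_pow]
  have hLpos : (0 : ℝ) < L := by exact_mod_cast (show 0 < L by omega)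
  have hsum_ge : 4 * casimirF n * (β₀ * ((((L * (L / 2) ^ (d + 1) : ℕ) : ℝ) *
      Real.exp (-(8 * n * (d + 1) * β₀))) * VH)) / (L : ℝ) ^ (d + 2) ≤ ∑ ν, Dμ ν := by
    rw [div_le_iff₀ (by positivity)]
    calc 4 * casimirF n * (β₀ * ((((L * (L / 2) ^ (d + 1) : ℕ) : ℝ) *
          Real.exp (-(8 * n * (d + 1) * β₀))) * VH))
        ≤ (Fintype.card (Site (d + 2) L) : ℝ) * ∑ ν, Dμ ν := htot
      _ = (∑ ν, Dμ ν) * (L : ℝ) ^ (d + 2) := by rw [hsite, mul_comm]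
  have hm₀μ : m₀ ≤ Dμ μ := by
    have hd2 : (0 : ℝ) < ((d + 2 : ℕ) : ℝ) := by positivity
    refine le_of_mul_le_mul_left (le_trans ?_ hμ) hd2
    refine le_trans ?_ hsum_ge
    rw [le_div_iff₀ (by positivity)]
    have h3 : (3 : ℝ) ^ (d + 1) ≠ 0 := by positivity
    have hd2' : ((d : ℝ) + 2) ≠ 0 := by positivity
    calc ((d + 2 : ℕ) : ℝ) * m₀ * (L : ℝ) ^ (d + 2)
        ≤ ((d + 2 : ℕ) : ℝ) * m₀ * (3 ^ (d + 1) * ((L * (L / 2) ^ (d + 1) : ℕ) : ℝ)) :=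
          mul_le_mul_of_nonneg_left hX (by positivity)
      _ = 4 * casimirF n * (β₀ * ((((L * (L / 2) ^ (d + 1) : ℕ) : ℝ) *
          Real.exp (-(8 * n * (d + 1) * β₀))) * VH)) := by
          rw [hm₀]; push_cast; field_simp
  -- the Schwinger–Dyson floor (item 127) for the even family in direction `μ`
  have hsum : ((evenLinks (L := L) μ).card : ℝ) * m₀ ≤ ∑ e ∈ evenLinks (L := L) μ, ∫ U, dirLap B.T
      (ambWilsonAction : AmbConfig (d + 2) L n → ℝ) e (coeConfig U)
      ∂(boltzmannMeasure fun U : GaugeConfig (d + 2) L (Matrix.specialUnitaryGroup (Fin n) ℂ) =>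
        u * ambWilsonAction (coeConfig U)) := by
    rw [sum_evenLinks_integral_dirLap B.T u μ]
    exact mul_le_mul_of_nonneg_left hm₀μ (Nat.cast_nonneg _)
  have hSD := Theory2.SchwingerDyson.variance_ge_of_sumMeanLap hS B.mem (evenLinks (L := L) μ) hu0
    (le_trans zero_le_one hc₂) hm₀pos.le
    (fun U e _ a => (hbd L U e a a).1) (fun U e _ a b => (hbd L U e a b).2.1)
    (fun U e _ a b => (hbd L U e a b).2.2)
    (wilson_loc₁ B.T μ) (wilson_loc₂ B.T μ)
    hsum
  -- compare the constants: `c · #plaquettes ≤ |M| · m₀² / D`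
  have hplaq :
      (Fintype.card (Plaquette (d + 2) L) : ℝ) ≤ ((d : ℝ) + 2) ^ 2 * (L : ℝ) ^ (d + 2) := by
    exact_mod_cast LatticeForm.card_plaquette_le (d := d + 2) (L := L)
  have hL3 : (L : ℝ) ^ (d + 2) ≤ 3 ^ (d + 2) * ((evenLinks (L := L) μ).card : ℝ) := by
    rw [card_evenLinks]
    exact_mod_cast pow_le_three_pow_mul_half_pow (d := d + 2) hL
  have hD0 : D ≠ 0 := hDpos.ne'
  have hu0' : u ≠ 0 := hu0.ne'
  have h32 : ((d : ℝ) + 2) ^ 2 * 3 ^ (d + 2) ≠ 0 := by positivity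
  calc m₀ ^ 2 / D / (((d : ℝ) + 2) ^ 2 * 3 ^ (d + 2)) * Fintype.card (Plaquette (d + 2) L) / u ^ 2
      ≤ m₀ ^ 2 / D / (((d : ℝ) + 2) ^ 2 * 3 ^ (d + 2)) *
          (((d : ℝ) + 2) ^ 2 * (3 ^ (d + 2) * ((evenLinks (L := L) μ).card : ℝ))) / u ^ 2 := by
        gcongr
        exact le_trans hplaq (mul_le_mul_of_nonneg_left hL3 (by positivity))
    _ = (evenLinks (L := L) μ).card * m₀ ^ 2 /
          ((Fintype.card B.ι : ℝ) ^ 2 * (2 * c₂ ^ 2 + c₁ * c₃)) / u ^ 2 := by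
        rw [← hD]
        field_simp
    _ ≤ _ := hSD

end Assembly

/-! ## §F. Docking with item 125: (SH_W) in its own words, and the now-unconditional layer laws -/

section Dock

open Summit.Ventures.LatticeQCDFlow.Theory2.SpecificHeat

/-- **DOCK (item 125's conjecture (SH_W), uniform in the volume, is a theorem):** for `n ≥ 2`,
`d ≥ 2`, `β₀ > 0` there is `c > 0` with `WilsonSpecificHeatFloorUniform d n β₀ c` — item 125's own
`Prop`, closed by `wilsonSpecificHeatFloorUniform` through definitional unfolding only. [ours] -/
theorem wilsonSpecificHeatFloorUniform_holds (hn : 2 ≤ n) (hd : 2 ≤ d) {β₀ : ℝ} (hβ₀ : 0 < β₀) :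
    ∃ c : ℝ, 0 < c ∧ WilsonSpecificHeatFloorUniform d n β₀ c :=
  wilsonSpecificHeatFloorUniform hn hd hβ₀

/-- **COROLLARY — item 125's WILSON `log² R` LAYER LAW, UNCONDITIONAL.**  For `n ≥ 2`, `d ≥ 2`,
`β₀ > 0` there is `c = c(d, n, β₀) > 0` such that in EVERY volume `L ≥ 2`, every monotone protocol
of exact reweighting steps `β₀ ≤ b₀ ≤ … ≤ b_m` obeys
`c·#plaq·log²R/(m + log R) ≤ Σ_j log E_{μ_{b_j}}[w_j²]`, `R = b_m/b₀`. [ours] -/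
theorem wilson_protocolLaw (hn : 2 ≤ n) (hd : 2 ≤ d) {β₀ : ℝ} (hβ₀ : 0 < β₀) :
    ∃ c : ℝ, 0 < c ∧ ∀ (L : ℕ) [NeZero L], 2 ≤ L → ∀ (m : ℕ), 0 < m →
      ∀ b : Fin (m + 1) → ℝ, β₀ ≤ b 0 → Monotone b →
        c * Fintype.card (Plaquette d L) * (Real.log (b (Fin.last m) / b 0)) ^ 2 /
            (m + Real.log (b (Fin.last m) / b 0)) ≤
          ∑ j : Fin m, Real.log (weightSqMoment (ambWilsonAction : AmbConfig d L n → ℝ)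
            (b j.castSucc) (b j.succ - b j.castSucc)) := by
  obtain ⟨c, hc, h⟩ := wilsonSpecificHeatFloorUniform_holds hn hd hβ₀
  exact ⟨c, hc, fun L _ hL m hm b hb0 hb =>
    wilson_protocolLaw_of_specificHeatFloor hβ₀ hc.le (h L hL) hm b hb0 hb⟩

/-- **COROLLARY — WILSON LAYERS NECESSARY, UNCONDITIONAL**: with the same `c`, in every volume
`L ≥ 2`, `Σ_j log E[w_j²] ≤ t` forces `m ≥ c·#plaq·log²R/t − log R` — the number of exact
reweighting / annealing layers is at least linear in the VOLUME times `log²` of the coupling ratio,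
for every monotone protocol. [ours] -/
theorem wilson_layers_necessary (hn : 2 ≤ n) (hd : 2 ≤ d) {β₀ : ℝ} (hβ₀ : 0 < β₀) :
    ∃ c : ℝ, 0 < c ∧ ∀ (L : ℕ) [NeZero L], 2 ≤ L → ∀ (m : ℕ), 0 < m →
      ∀ b : Fin (m + 1) → ℝ, β₀ ≤ b 0 → Monotone b → ∀ t : ℝ, 0 < t →
        (∑ j : Fin m, Real.log (weightSqMoment (ambWilsonAction : AmbConfig d L n → ℝ)
            (b j.castSucc) (b j.succ - b j.castSucc))) ≤ t →
          c * Fintype.card (Plaquette d L) * (Real.log (b (Fin.last m) / b 0)) ^ 2 / t -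
              Real.log (b (Fin.last m) / b 0) ≤ m := by
  obtain ⟨c, hc, h⟩ := wilsonSpecificHeatFloorUniform_holds hn hd hβ₀
  exact ⟨c, hc, fun L _ hL m hm b hb0 hb t ht hcost =>
    SpecificHeat.wilson_layers_necessary hβ₀ hc.le (h L hL) hm b hb0 hb ht hcost⟩

/-- **COROLLARY — WILSON PER-STEP WINDOW LAW, UNCONDITIONAL**: with the same `c`, if every exact
reweighting step has `log E[w_j²] ≤ t₀` (`t₀ ≥ 0`) then `log R ≤ m·(t₀/K + √(t₀/K))`,
`K = c·#plaq` — at least `½√(c·#plaq/t₀)·log R` windows when `t₀ ≤ K`. [ours] -/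
theorem wilson_logRatio_le_of_stepCost (hn : 2 ≤ n) (hd : 2 ≤ d) {β₀ : ℝ} (hβ₀ : 0 < β₀) :
    ∃ c : ℝ, 0 < c ∧ ∀ (L : ℕ) [NeZero L], 2 ≤ L → ∀ (m : ℕ) (b : Fin (m + 1) → ℝ),
      β₀ ≤ b 0 → Monotone b → ∀ t₀ : ℝ, 0 ≤ t₀ →
        (∀ j : Fin m, Real.log (weightSqMoment (ambWilsonAction : AmbConfig d L n → ℝ)
            (b j.castSucc) (b j.succ - b j.castSucc)) ≤ t₀) →
          Real.log (b (Fin.last m) / b 0) ≤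
            m * (t₀ / (c * Fintype.card (Plaquette d L)) +
              Real.sqrt (t₀ / (c * Fintype.card (Plaquette d L)))) := by
  obtain ⟨c, hc, h⟩ := wilsonSpecificHeatFloorUniform_holds hn hd hβ₀
  refine ⟨c, hc, fun L _ hL m b hb0 hb t₀ ht hstep => ?_⟩
  have hK : 0 < c * Fintype.card (Plaquette d L) := by
    have : 0 < Fintype.card (Plaquette d L) := by
      obtain ⟨d', rfl⟩ : ∃ d', d = d' + 2 := ⟨d - 2, by omega⟩
      exact Fintype.card_pos_iff.2
        ⟨((0 : Site (d' + 2) L), ⟨((0 : Fin (d' + 2)), (1 : Fin (d' + 2))), Fin.zero_lt_one⟩)⟩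
    positivity
  exact SpecificHeat.wilson_logRatio_le_of_stepCost hβ₀ hK (h L hL) b hb0 hb ht hstep

end Dock

end Summit.Ventures.LatticeQCDFlow.Theory2.WilsonSpecificHeat

end
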